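import Summits.BirchSwinnertonDyer.BirchSwinnertonDyer.Theorems.KolyvaginRoadThreeFrameRigidity
import HarnessLib

/-!
# Route `KolyvaginRoadThree`, deciding crux `ZhangSharpFrameAtThreeHL` (item stmt-BirchSwinnertonDyer-19574): the
# PER-PAIR CONSUMER of a derived-point certificate on atom A1 — ONE non-3-divisible derived Heegner point `P(n)` at
# ONE Hoffstein–Luo frame ⟹ `BSD(E,3)`, first-order binders only
# (cell `bsd-stepL`, seat `bsd-stepL-zhang3-p1` g3; `--supports stmt-BirchSwinnertonDyer-19574`, helper)

THEOREMS ONLY (no definition, no named fact, no `sorry`); nothing about any particular curve is asserted; every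
published input is a named fact of the tree taken as a binder. PARTITION: O2@3 (B10) × A1 (1 116 TRUE-OPEN classes;
cw 248 943) — types-the-object-of (the Lean shape in which a derived-point computation on an A1 pair — koly's kit
engine, `KOLY-WITNESS.md`: 9 pairs certified incl. the BC5 rung 347253a1 ⊗ ℚ(√−11), ℓ = 2 — would be CONSUMED;
whether such a certificate books a pair is the planner's ∕ referee's word, not this file's); closes: none.

WHAT A COMPUTATION DELIVERS: for an A1 curve `E` (X11b@3, (ram), `3 ∤ ∏c`), a Hoffstein–Luo field `K` (d_K odd,
Heegner, `L(E^{d_K},1) ≠ 0`), a Manin-good frame `(Dt, β, ι)` and a square-free product `n` of Zhang–Kolyvagin primes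
for `p = 3`: a Kolyvagin–Heegner datum `d` of conductor `n` (the CM point `x_n`, generators `σ_ℓ`, coset
representatives `S`) whose derived point `P(n) = Σ_{s ∈ S} s D_n y(n)` is NOT divisible by `3` in `E(K[n])`
(`¬ Koly.PDiv d 3 1`; exact linear algebra in `E(K[n])`). THIS FILE: that single statement ⟹ `BSDp W 3`
(`Koly.bsdp_three_of_not_pDiv_at_hlFrame`): the lower levels of the tower come from Gross 1991 §3
(`nonempty_kolyvaginHeegnerData_of_grossCM`, koly p423680), the class `c₁(n) ≠ 0` from zhang3-p1 g0's
`KolyCert.kolyvaginClass_three_ne_zero_of_tower_not_pDiv` (p418676), and `BSDp W 3` from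
`Koly.bsdp_three_of_kolyvaginClass_one_ne_zero_at_hlFrame` (p432540: Heegner datum, Heegner point, minimal twist,
conductor-1 datum, arithmetic of `E(K)` discharged; koly's end-to-end p410016 underneath). And then, by
`Koly.kolyvaginClass_one_ne_zero_of_bsdp_of_hlFrame` (p431973), EVERY Hoffstein–Luo frame of `E` carries a non-zero
class (`Koly.kolyvaginClass_one_ne_zero_allHLFrames_of_not_pDiv`) — in particular the registered BC5 rung
`stub_rung_347253a1` (all frames of all fields with `d_K = −11`) follows from ONE certificate at ONE frame, modulo
the published inputs and the certificate.

References (locators only): [cite: McCallumLMS1991, §4 Cor. 4.5, §5 Lemma 5.1 and Cor. 5.6] [cite: GrossLMS1991, §3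
(pp. 238–239), Prop. 3.6, §4 (4.1)] [cite: WZhang2014, Remark 5 and Thm. 10.2] [cite: JetchevLauterStein2009, §4.2
(the derived-point computation template)].
-/

noncomputable section

open scoped Classical

namespace Summit.BirchSwinnertonDyer.Rank1Residual.X11b.Three.Koly

open WeierstrassCurve NumberField Literature.NumberTheory.EllipticCurves
  Literature.NumberTheory.EllipticCurves.ModularForms
  Literature.NumberTheory.EllipticCurves.Rank1Residual
  Summit.BirchSwinnertonDyer.Rank1Residual Summit.BirchSwinnertonDyer.Rank1Residual.X11b

/-- **PER-PAIR CONSUMER on A1: one non-3-divisible derived Heegner point ⟹ `BSD(E,3)`.**  Data: `W/ℚ` globally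
minimal with `(E,3) ∈ X11b`, a (ram) witness, `3 ∤ ∏_ℓ c_ℓ(E)`; `K` imaginary quadratic, `d_K` odd, Heegner for
`N_E`, `L(E^{d_K},1) ≠ 0`; a frame `(Dt, β, ι)` with `3 ∤ c(Dt)` (the orientation `4N ∣ β² − d_K` is carried by the
datum); a square-free product `n` of Zhang–Kolyvagin primes for `p = 3` and ONE Kolyvagin–Heegner datum `d` of
conductor `n` on the frame with `P(n) ∉ 3·E(K[n])` (`¬ PDiv d 3 1` — the HYPOTHESIS a computation certifies).
PUBLISHED inputs as binders (Gross–Zagier, Kolyvagin ×2, Skinner 2016 Thm. C, GZK, modularity, Shimura reciprocity at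
conductor 1, Gross 1991 §3 ×2, McCallum Cor. 5.6 certificate half). CONCLUSION: `BSDp W 3`. CONDITIONAL on every
binder; nothing is asserted about any curve; whether a certificate books a pair is not decided here.
[cite: McCallumLMS1991, §4 Cor. 4.5 and §5 Cor. 5.6] [cite: GrossLMS1991, §3, Prop. 3.6, §4 (4.1)] -/
theorem bsdp_three_of_not_pDiv_at_hlFrame
    (W : WeierstrassCurve ℚ) [W.IsElliptic] [W.IsGloballyMinimal] [NeZero (W.conductorNorm ℤ)]
    (K : Type) [Field K] [NumberField K]
    (Dt : ModularParametrizationData W (W.conductorNorm ℤ)) (β : ℤ) (ι : K →+* ℂ)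
    -- published inputs (named facts of the tree)
    (hGZ : gross_zagier (W.conductorNorm ℤ) W K) (hKo : kolyvagin (W.conductorNorm ℤ) W K)
    (hB : Kolyvagin1990_padicValNat_card_sha_le (W.conductorNorm ℤ) W K)
    (hSk : Skinner2016.thmC_padicValRat_bsd_rank_zero)
    (hGZK : rank_eq_analyticRank_of_analyticRank_le_one) (hmod : hasEntireLFunction_rat)
    (hrec : heegnerPointOfConductor_one_galoisConj (W.conductorNorm ℤ) W K)
    (h1 : phi_heegnerPointOfConductor_mem_range_map_ringClassField (W.conductorNorm ℤ) W K)
    (h2 : exists_generator_ringClassGalOver K)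
    (hMc : McCallum1991_pow_dvd_card_sha_primary_of_certificate)
    -- the pair (A1) and the HL frame
    (hX : ClassX11b W 3) (hram : Ram W 3) (htam : ¬ 3 ∣ W.tamagawaProduct)
    (hK : IsImaginaryQuadratic K) (hodd : Odd (NumberField.discr K))
    (hH : SatisfiesHeegnerHypothesis (W.conductorNorm ℤ) K)
    (hLt : (W.quadraticTwist (NumberField.discr K : ℚ)).entireLFunction 1 ≠ 0) (hc : ¬ (3 : ℤ) ∣ Dt.c)
    -- THE CERTIFICATE: one datum at a level `n ∈ Λ₃` whose derived point is not 3-divisible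
    {n : ℕ} (hn : KolyvaginDescent.KolSupp (Zhang2014.IsKolyvaginPrime (W.conductorNorm ℤ) W K 3) n)
    (d : KolyvaginHeegnerData Dt β ι n) (hcert : ¬ PDiv d 3 1) :
    BSDp W 3 := by
  have hmult : W.HasMultiplicativeReductionAtPrime 3 := hX.2.2.1
  have hρ : Surj W 3 := surj_of_irr_of_ram W 3 hX.2.2.2 hram
  have hβ : (4 * (W.conductorNorm ℤ : ℤ)) ∣ β ^ 2 - NumberField.discr K := d.dvd_sq_sub
  -- the tower below `d` (Gross 1991 §3 at the lower levels)
  have hinert : ∀ m : ℕ, m ∣ n → ∀ q ∈ m.primeFactors, (Ideal.span {(q : 𝓞 K)}).IsPrime :=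
    fun m hm q hq ↦ (hn.2 q (Nat.primeFactors_mono hm hn.1.ne_zero hq)).2.2.2.2.1
  have hKD : ∀ m : ℕ, m ∣ n → Nonempty (KolyvaginHeegnerData Dt β ι m) := fun m hm ↦
    Summit.BirchSwinnertonDyer.BirchSwinnertonDyer.Theorems.nonempty_kolyvaginHeegnerData_of_grossCM h1 h2 hK hH
      Dt β ι hβ (hn.1.squarefree_of_dvd hm) (hinert m hm)
  let dd : (m : ℕ) → m ∣ n → KolyvaginHeegnerData Dt β ι m := fun m hm ↦
    if h : m = n then h ▸ d else Classical.choice (hKD m hm)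
  have hdd : dd n dvd_rfl = d := by
    show (if h : n = n then h ▸ d else _) = d
    rw [dif_pos rfl]
  have hcert' : ¬ PDiv (dd n dvd_rfl) 3 1 := by rwa [hdd]
  -- the class `c₁(n) ≠ 0` (g0's tower theorem), then END TO END
  have hne := KolyCert.kolyvaginClass_three_ne_zero_of_tower_not_pDiv W K Dt β ι hmult hρ hK hH hn dd hcert'
  rw [hdd] at hne
  exact bsdp_three_of_kolyvaginClass_one_ne_zero_at_hlFrame W K Dt β ι hGZ hKo hB hSk hGZK hmod hrec h1 h2 hMc hX
    hram htam hK hodd hH hLt hβ hc d hn hne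

/-- **… and then EVERY Hoffstein–Luo frame of the curve carries a non-zero mod-3 Kolyvagin class** (one certificate
at one frame ⟹ `BSDp W 3` ⟹ `Koly.kolyvaginClass_one_ne_zero_of_bsdp_of_hlFrame`, McCallum's divisibility half
`hMcU`): the per-pair content of the deciding crux — and of the BC5 rung `stub_rung_347253a1`, which quantifies over
all frames of all fields with `d_K = −11` — is ONE certificate. PUBLISHED inputs at both fields as binders.
CONDITIONAL on every binder; nothing is asserted about any curve. [cite: McCallumLMS1991, §5 Lemma 5.1 and Cor. 5.6]
[cite: WZhang2014, Remark 5 and Thm. 10.2] -/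
theorem kolyvaginClass_one_ne_zero_allHLFrames_of_not_pDiv
    (W : WeierstrassCurve ℚ) [W.IsElliptic] [W.IsGloballyMinimal] [NeZero (W.conductorNorm ℤ)]
    -- published inputs (named facts of the tree), quantified over the fields
    (hGZ : ∀ (K : Type) [Field K] [NumberField K], gross_zagier (W.conductorNorm ℤ) W K)
    (hKo : ∀ (K : Type) [Field K] [NumberField K], kolyvagin (W.conductorNorm ℤ) W K)
    (hB : ∀ (K : Type) [Field K] [NumberField K], Kolyvagin1990_padicValNat_card_sha_le (W.conductorNorm ℤ) W K)
    (hSk : Skinner2016.thmC_padicValRat_bsd_rank_zero)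
    (hGZK : rank_eq_analyticRank_of_analyticRank_le_one) (hmod : hasEntireLFunction_rat)
    (hrec : ∀ (K : Type) [Field K] [NumberField K], heegnerPointOfConductor_one_galoisConj (W.conductorNorm ℤ) W K)
    (h1 : ∀ (K : Type) [Field K] [NumberField K],
      phi_heegnerPointOfConductor_mem_range_map_ringClassField (W.conductorNorm ℤ) W K)
    (h2 : ∀ (K : Type) [Field K] [NumberField K], exists_generator_ringClassGalOver K)
    (hMc : McCallum1991_pow_dvd_card_sha_primary_of_certificate)
    (hMcU : McCallum1991_padicValNat_card_sha_primary_add_le_of_globalDivisibility)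
    -- the pair (A1)
    (hX : ClassX11b W 3) (hram : Ram W 3) (htam : ¬ 3 ∣ W.tamagawaProduct)
    -- THE CERTIFICATE at one HL frame
    (K₀ : Type) [Field K₀] [NumberField K₀]
    (Dt₀ : ModularParametrizationData W (W.conductorNorm ℤ)) (β₀ : ℤ) (ι₀ : K₀ →+* ℂ)
    (hK₀ : IsImaginaryQuadratic K₀) (hodd₀ : Odd (NumberField.discr K₀))
    (hH₀ : SatisfiesHeegnerHypothesis (W.conductorNorm ℤ) K₀)
    (hLt₀ : (W.quadraticTwist (NumberField.discr K₀ : ℚ)).entireLFunction 1 ≠ 0) (hc₀ : ¬ (3 : ℤ) ∣ Dt₀.c)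
    {n₀ : ℕ} (hn₀ : KolyvaginDescent.KolSupp (Zhang2014.IsKolyvaginPrime (W.conductorNorm ℤ) W K₀ 3) n₀)
    (d₀ : KolyvaginHeegnerData Dt₀ β₀ ι₀ n₀) (hcert₀ : ¬ PDiv d₀ 3 1)
    -- ANY HL frame
    (K : Type) [Field K] [NumberField K]
    (Dt : ModularParametrizationData W (W.conductorNorm ℤ)) (β : ℤ) (ι : K →+* ℂ)
    (hK : IsImaginaryQuadratic K) (hodd : Odd (NumberField.discr K))
    (hH : SatisfiesHeegnerHypothesis (W.conductorNorm ℤ) K)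
    (hLt : (W.quadraticTwist (NumberField.discr K : ℚ)).entireLFunction 1 ≠ 0)
    (hβ : (4 * (W.conductorNorm ℤ : ℤ)) ∣ β ^ 2 - NumberField.discr K) (hc : ¬ (3 : ℤ) ∣ Dt.c) :
    ∃ (n : ℕ) (d : KolyvaginHeegnerData Dt β ι n),
      KolyvaginDescent.KolSupp (Zhang2014.IsKolyvaginPrime (W.conductorNorm ℤ) W K 3) n ∧
        d.kolyvaginClass Nat.prime_three 1 ≠ 0 :=
  kolyvaginClass_one_ne_zero_of_bsdp_of_hlFrame W K Dt β ι (hGZ K) (hKo K) hSk hGZK hmod (hrec K) (h1 K) (h2 K)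
    hMcU hX hram htam hK hodd hH hLt hβ hc
    (bsdp_three_of_not_pDiv_at_hlFrame W K₀ Dt₀ β₀ ι₀ (hGZ K₀) (hKo K₀) (hB K₀) hSk hGZK hmod (hrec K₀) (h1 K₀)
      (h2 K₀) hMc hX hram htam hK₀ hodd₀ hH₀ hLt₀ hc₀ hn₀ d₀ hcert₀)

end Summit.BirchSwinnertonDyer.Rank1Residual.X11b.Three.Koly

end
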